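/- Width seat `ym-line-sfw-p2-w5` (prover-ym-line-sfw-p2-w5-g18-0), free hands on planner ym-idea-2 g16's LINE-19 entry kit
(crux `AllWindowsColdBox.BoxHighWindowsSU22` = stmt-QuantumFields-24004 / low item 24335, stub S4b `stub_landauRepresentative`):
PARTS A + C + D of the planner's checked draft `l26/H4b0abc-LandauStageI-DRAFT.lean` (sha16 fa798203bc602e43) = S4b STAGE I. -/
import Summits.QuantumFields.YangMills.Theorems.AllWindowsColdBoxBoxHighWindowsSU22LineDefs
import Summits.QuantumFields.YangMills.Theorems.AllWindowsColdBoxBoxHighLineKernelHodgeForm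
import Summits.QuantumFields.YangMills.Theorems.AllWindowsColdBoxBoxHighLineSU2Key
import Summits.QuantumFields.YangMills.Theorems.AllWindowsColdBoxDirProjKernelHodgeForm
import Summits.QuantumFields.YangMills.Theorems.WeakCouplingRatesLargeFieldTail
import Summits.QuantumFields.YangMills.Theorems.WeakCouplingRatesBulkDominatesColdBoxWDatumCompetitor
import Summits.QuantumFields.YangMills.Theorems.WeakCouplingRatesColdBoxLinkSmall
import Summits.QuantumFields.YangMills.Theorems.WeakCouplingRatesColdBoxLargeFieldSU2

/-!
# LINE-19 S4b STAGE I: the crude Landau representative (H4b.0a existence · H4b.0b Landau condition · H4b.0c size `≤ 72900·H⁸·s²`)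

For the registered stub S4b `stub_landauRepresentative : LandauRepresentativeBound` of LINE-19 «Landau sector: log-concave reduction +
relative second order» (skeleton v9 `f1519a877fd86581`; plan of record `Cruxes/BoxHighWindowsSU22/STUB-PLAN-S4b.md`), Stage I of the plan:

* H4b.0a `exists_isMinOn_landauFunctional`: the Landau functional `g ↦ Σ_{e ∈ box} linkDefect (U^g)_e` (`landauFunctional`) attains its
  minimum over INTERIOR gauge transforms (compactness of `SU(2)^{interior}`, `extInterior`);
* H4b.0b `inLandauGauge_of_isMinOn`: an interior minimiser is in lattice LANDAU GAUGE `InLandauGauge` exactly as typed in the skeleton —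
  by the first-variation formula `landauFunctional_update` (`LF(update g x (q·g x)) = LF g + Re tr((1 − q)·N_x(U^g))`, one-site update,
  `linkDefect_update`, the 8-edge filters `filter_fst_eq`/`filter_snd_eq` over ✓`HodgeForm.mem_boxEdges_of_endpoint`) and the 2×2 key lemma
  `SU2Key.conjTranspose_eq_of_forall_re_trace_le` (module `…BoxHighLineSU2Key`); `exists_interior_landauGauge_min`;
* H4b.0c `landauMin_le_forest` (= Prop H4b0c of the plan verbatim, `C = 72900`) and `exists_landau_inGaugeBall`: on `ColdWall ∧ SmallPlaquettes s`
  the minimiser's functional is `≤` that of the temporal-forest representative `forestFix` (`forestGauge_isInteriorGauge`,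
  `linkDefect_forestFix_le` from the forest Poincaré ladder ✓`WeakCouplingRates.linkCost_le_of_plaqCost_le`, `landauFunctional_forestGauge_le` via
  `card_boxEdges_four_le`), so EVERY box link of the Landau representative has defect `≤ 72900·H⁸·s²`; `base_bounds_of_mem_plaquettesTouching`
  (plaquettes touching the cold box are based in `[−1,2H]⁴`), `linkDefect_nonneg`.

What this buys for S4b: the representative EXISTS with the Landau condition and a crude polynomial a-priori size; Stage II (H4b.1–3: Hodge-gauge
row sums, BCH, `∇Δ₀⁻¹` row sum, continuity) must sharpen it to the registered per-link `C·H²(1+log H)²·s²` — the crude bound is the starting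
point of that argument, not a substitute.  Author of the mathematics and the Lean text: planner ym-idea-2 g16 (checked draft kit, rc 0 · 0 sorry ·
axioms standard); this seat split the kit into modules (LineDefs ✓, `SU2Key`, `KernelHodgeForm` for `interiorSites_iff`), re-homed nothing else,
and re-checked.  HONEST LABEL: helper lemmas toward ONE registered stub of a critic-PASSed line on the R2ξ″ RECORD-rung crux 24004 / 24335;
no stub is proved by name, no crux, rung or summit is proved; the Yang–Mills mass gap is NOT proved by this file.
-/

set_option autoImplicit false

noncomputable section

open MeasureTheory Matrix
open Literature.MathematicalPhysics.QuantumFieldTheory hiding boxEdges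
open Literature.MathematicalPhysics.QuantumFieldTheory.LatticeMaxwell
open Literature.MathematicalPhysics.QuantumFieldTheory.AxialGauge
open Summit.QuantumFields.YangMills.Theorems.WeakCouplingRates

/-! ## H4b.0a: existence of a minimiser of the Landau functional over interior gauges (compactness) -/

namespace Summit.QuantumFields.YangMills.Theorems.AllWindowsColdBoxBoxHighLine

open Literature.Probability.LatticeModels (Site)
open Literature.MathematicalPhysics.QuantumLattice

/-- The Landau functional `Σ_{e ∈ box} (2 − Re tr (U^g)_e)` of a gauge transform `g`. -/
def landauFunctional (H : ℕ) (U : LGConfig 4 SU2) (g : Site 4 → SU2) : ℝ :=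
  ∑ e ∈ boxEdges 4 (2 * H + 1), linkDefect (gaugeTransformZd g U) e

/-- Extension of an interior gauge datum by `1`. -/
def extInterior (H : ℕ) (φ : interiorSites H → SU2) : Site 4 → SU2 :=
  fun x => if hx : x ∈ interiorSites H then φ ⟨x, hx⟩ else 1

/-- The extension by `1` is an interior gauge transform. -/
theorem extInterior_isInteriorGauge (H : ℕ) (φ : interiorSites H → SU2) : IsInteriorGauge H (extInterior H φ) := by
  intro x hx; simp [extInterior, hx]

/-- An interior gauge transform is the extension of its restriction to the interior sites. -/
theorem extInterior_restrict (H : ℕ) {g : Site 4 → SU2} (hg : IsInteriorGauge H g) :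
    extInterior H (fun x : interiorSites H => g x) = g := by
  funext x
  by_cases hx : x ∈ interiorSites H
  · simp [extInterior, hx]
  · simp [extInterior, hx, hg x hx]

/-- Each value of the extension depends continuously on the interior datum. -/
theorem continuous_extInterior_apply (H : ℕ) (x : Site 4) :
    Continuous fun φ : interiorSites H → SU2 => extInterior H φ x := by
  by_cases hx : x ∈ interiorSites H
  · simp only [extInterior, hx, dif_pos]; exact continuous_apply _
  · simp only [extInterior, hx, dif_neg, not_false_eq_true]; exact continuous_const

/-- The Landau functional is continuous on the compact space of interior data. -/
theorem continuous_landauFunctional_ext (H : ℕ) (U : LGConfig 4 SU2) :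
    Continuous fun φ : interiorSites H → SU2 => landauFunctional H U (extInterior H φ) := by
  unfold landauFunctional
  refine continuous_finsetSum _ fun e _ => ?_
  have hc : Continuous fun φ : interiorSites H → SU2 =>
      ((gaugeTransformZd (extInterior H φ) U e : SU2) : Matrix (Fin 2) (Fin 2) ℂ) := by
    refine continuous_subtype_val.comp ?_
    show Continuous fun φ : interiorSites H → SU2 =>
      extInterior H φ e.1 * U e * (extInterior H φ (e.1 + Pi.single e.2 1))⁻¹
    exact ((continuous_extInterior_apply H e.1).mul continuous_const).mul
      (continuous_extInterior_apply H _).inv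
  show Continuous fun φ : interiorSites H → SU2 =>
    2 - (((gaugeTransformZd (extInterior H φ) U e : SU2) : Matrix (Fin 2) (Fin 2) ℂ).trace).re
  exact continuous_const.sub (Complex.continuous_re.comp hc.matrix_trace)

/-- **H4b.0a**: the Landau functional attains its minimum over interior gauge transformations (compactness of `SU(2)^{interior}`). -/
theorem exists_isMinOn_landauFunctional (H : ℕ) (U : LGConfig 4 SU2) :
    ∃ g : Site 4 → SU2, IsInteriorGauge H g ∧
      ∀ g' : Site 4 → SU2, IsInteriorGauge H g' → landauFunctional H U g ≤ landauFunctional H U g' := by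
  obtain ⟨φ₀, -, hmin⟩ :=
    isCompact_univ.exists_isMinOn Set.univ_nonempty (continuous_landauFunctional_ext H U).continuousOn
  refine ⟨extInterior H φ₀, extInterior_isInteriorGauge H φ₀, fun g' hg' => ?_⟩
  have h := (isMinOn_iff.mp hmin) (fun x : interiorSites H => g' x) (Set.mem_univ _)
  simpa only [extInterior_restrict H hg'] using h

end Summit.QuantumFields.YangMills.Theorems.AllWindowsColdBoxBoxHighLine

/-! ## H4b.0b: an interior minimiser of the Landau functional is in lattice Landau gauge
(first variation along the rational SU(2) test family; no `Matrix.exp`, no derivatives). -/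

namespace Summit.QuantumFields.YangMills.Theorems.AllWindowsColdBoxBoxHighLine

open Literature.Probability.LatticeModels (Site)
open Literature.MathematicalPhysics.QuantumLattice

/-- The site matrix `N_x(W) = Σ_μ W(x,μ) + Σ_μ W(x − e_μ, μ)ᴴ`; its Hermiticity is the Landau condition at `x`. -/
def siteMat (W : LGConfig 4 SU2) (x : Site 4) : Matrix (Fin 2) (Fin 2) ℂ :=
  ∑ μ : Fin 4, (W (x, μ) : Matrix (Fin 2) (Fin 2) ℂ) + ∑ μ : Fin 4, (W (x - Pi.single μ 1, μ) : Matrix (Fin 2) (Fin 2) ℂ)ᴴ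

variable {H : ℕ}

/-- A one-site update at an interior site of an interior gauge transform is interior. -/
theorem update_isInteriorGauge {g : Site 4 → SU2} (hg : IsInteriorGauge H g) {x : Site 4}
    (hx : x ∈ interiorSites H) (q : SU2) : IsInteriorGauge H (Function.update g x (q * g x)) := by
  intro y hy
  have hne : y ≠ x := fun h => hy (h ▸ hx)
  rw [Function.update_of_ne hne]; exact hg y hy

/-- `y + e_μ ≠ y`. -/
theorem ne_of_add_single (y : Site 4) (μ : Fin 4) : y + Pi.single μ 1 ≠ y := by
  intro h
  have := congrFun h μ
  simp at this

/-- Outgoing edges at `x` pick up `q` on the left. -/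
theorem gt_update_out (g : Site 4 → SU2) (U : LGConfig 4 SU2) (x : Site 4) (q : SU2) (e : Literature.MathematicalPhysics.QuantumLattice.ZdEdge 4) (h1 : e.1 = x) :
    gaugeTransformZd (Function.update g x (q * g x)) U e = q * gaugeTransformZd g U e := by
  subst h1
  unfold gaugeTransformZd
  rw [Function.update_self, Function.update_of_ne (ne_of_add_single e.1 e.2), mul_assoc, mul_assoc, mul_assoc]

/-- Incoming edges at `x` pick up `q⁻¹` on the right. -/
theorem gt_update_in (g : Site 4 → SU2) (U : LGConfig 4 SU2) (x : Site 4) (q : SU2) (e : Literature.MathematicalPhysics.QuantumLattice.ZdEdge 4)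
    (h2 : e.1 + Pi.single e.2 1 = x) :
    gaugeTransformZd (Function.update g x (q * g x)) U e = gaugeTransformZd g U e * q⁻¹ := by
  subst h2
  unfold gaugeTransformZd
  rw [Function.update_self, Function.update_of_ne (ne_of_add_single e.1 e.2).symm, _root_.mul_inv_rev, ← mul_assoc]

/-- Other edges are unchanged. -/
theorem gt_update_else (g : Site 4 → SU2) (U : LGConfig 4 SU2) (x : Site 4) (q : SU2) (e : Literature.MathematicalPhysics.QuantumLattice.ZdEdge 4)
    (h1 : e.1 ≠ x) (h2 : e.1 + Pi.single e.2 1 ≠ x) :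
    gaugeTransformZd (Function.update g x (q * g x)) U e = gaugeTransformZd g U e := by
  unfold gaugeTransformZd
  rw [Function.update_of_ne h1, Function.update_of_ne h2]

/-- Pointwise variation of the link defect under the one-site update. -/
theorem linkDefect_update (g : Site 4 → SU2) (U : LGConfig 4 SU2) (x : Site 4) (q : SU2) (e : Literature.MathematicalPhysics.QuantumLattice.ZdEdge 4) :
    linkDefect (gaugeTransformZd (Function.update g x (q * g x)) U) e =
      linkDefect (gaugeTransformZd g U) e +
        (if e.1 = x then
          ((1 - (q : Matrix (Fin 2) (Fin 2) ℂ)) * ((gaugeTransformZd g U e : SU2) : Matrix (Fin 2) (Fin 2) ℂ)).trace.re else 0) +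
        (if e.1 + Pi.single e.2 1 = x then
          ((1 - (q : Matrix (Fin 2) (Fin 2) ℂ)) * ((gaugeTransformZd g U e : SU2) : Matrix (Fin 2) (Fin 2) ℂ)ᴴ).trace.re else 0) := by
  -- in `SU(2)` the inverse is the adjoint, as matrices (tree: `FemtoTransferGap.TwoLattice.Magnetic.su2_coe_inv`; `rfl`)
  have coe_inv_SU2 : ∀ q' : SU2, ((q'⁻¹ : SU2) : Matrix (Fin 2) (Fin 2) ℂ) = (q' : Matrix (Fin 2) (Fin 2) ℂ)ᴴ := fun _ => rfl
  by_cases h1 : e.1 = x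
  · have h2 : e.1 + Pi.single e.2 1 ≠ x := by rw [← h1]; exact ne_of_add_single e.1 e.2
    rw [if_pos h1, if_neg h2, linkDefect, linkDefect, gt_update_out g U x q e h1, Submonoid.coe_mul,
      Matrix.sub_mul, Matrix.one_mul, Matrix.trace_sub, Complex.sub_re]
    ring
  · by_cases h2 : e.1 + Pi.single e.2 1 = x
    · rw [if_neg h1, if_pos h2, linkDefect, linkDefect, gt_update_in g U x q e h2, Submonoid.coe_mul, coe_inv_SU2,
        Matrix.sub_mul, Matrix.one_mul, Matrix.trace_sub, Complex.sub_re]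
      have hA : (((gaugeTransformZd g U e : SU2) : Matrix (Fin 2) (Fin 2) ℂ) * (q : Matrix (Fin 2) (Fin 2) ℂ)ᴴ) =
          ((q : Matrix (Fin 2) (Fin 2) ℂ) * ((gaugeTransformZd g U e : SU2) : Matrix (Fin 2) (Fin 2) ℂ)ᴴ)ᴴ := by
        rw [Matrix.conjTranspose_mul, Matrix.conjTranspose_conjTranspose]
      rw [hA, Matrix.trace_conjTranspose, Matrix.trace_conjTranspose]
      simp only [Complex.star_def, Complex.conj_re]
      ring
    · rw [if_neg h1, if_neg h2, linkDefect, linkDefect, gt_update_else g U x q e h1 h2, add_zero, add_zero]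

/-- The outgoing edges at an interior site, as a filter of the box edges. -/
theorem filter_fst_eq {x : Site 4} (hx : ∀ k : Fin 4, 1 ≤ x k ∧ x k + 1 ≤ 2 * (H : ℤ)) :
    (boxEdges 4 (2 * H + 1)).filter (fun e : Literature.MathematicalPhysics.QuantumLattice.ZdEdge 4 => e.1 = x) =
      (Finset.univ : Finset (Fin 4)).image (fun μ => (x, μ)) := by
  ext ⟨y, μ⟩
  simp only [Finset.mem_filter, Finset.mem_image, Finset.mem_univ, true_and, Prod.mk.injEq]
  constructor
  · rintro ⟨-, rfl⟩; exact ⟨μ, rfl, rfl⟩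
  · rintro ⟨μ', rfl, rfl⟩
    exact ⟨Summit.QuantumFields.YangMills.Theorems.AllWindowsColdBox.HodgeForm.mem_boxEdges_of_endpoint hx (Or.inr rfl), rfl⟩

/-- The incoming edges at an interior site, as a filter of the box edges. -/
theorem filter_snd_eq {x : Site 4} (hx : ∀ k : Fin 4, 1 ≤ x k ∧ x k + 1 ≤ 2 * (H : ℤ)) :
    (boxEdges 4 (2 * H + 1)).filter (fun e : Literature.MathematicalPhysics.QuantumLattice.ZdEdge 4 => e.1 + Pi.single e.2 1 = x) =
      (Finset.univ : Finset (Fin 4)).image (fun μ => (x - Pi.single μ 1, μ)) := by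
  ext ⟨y, μ⟩
  simp only [Finset.mem_filter, Finset.mem_image, Finset.mem_univ, true_and, Prod.mk.injEq]
  constructor
  · rintro ⟨-, h⟩; exact ⟨μ, by rw [← h, add_sub_cancel_right], rfl⟩
  · rintro ⟨μ', h, rfl⟩
    have h' : y + Pi.single μ' 1 = x := by rw [← h, sub_add_cancel]
    exact ⟨Summit.QuantumFields.YangMills.Theorems.AllWindowsColdBox.HodgeForm.mem_boxEdges_of_endpoint hx (Or.inl h'), h'⟩

/-- **First-variation formula** at an interior site. -/
theorem landauFunctional_update (U : LGConfig 4 SU2) (g : Site 4 → SU2) {x : Site 4} (hx : x ∈ interiorSites H) (q : SU2) :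
    landauFunctional H U (Function.update g x (q * g x)) =
      landauFunctional H U g + ((1 - (q : Matrix (Fin 2) (Fin 2) ℂ)) * siteMat (gaugeTransformZd g U) x).trace.re := by
  have hx' := (interiorSites_iff H x).mp hx
  unfold landauFunctional
  simp_rw [linkDefect_update g U x q]
  rw [Finset.sum_add_distrib, Finset.sum_add_distrib, ← Finset.sum_filter, ← Finset.sum_filter, filter_fst_eq hx',
    filter_snd_eq hx', Finset.sum_image (fun _ _ _ _ h => (Prod.ext_iff.mp h).2),
    Finset.sum_image (fun _ _ _ _ h => (Prod.ext_iff.mp h).2), add_assoc]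
  congr 1
  simp only [siteMat, Matrix.mul_add, Finset.mul_sum, Matrix.trace_add, Matrix.trace_sum, Complex.add_re, Complex.re_sum]

/-- The site matrix of an `SU(2)` configuration has real trace. -/
theorem siteMat_trace_im (W : LGConfig 4 SU2) (x : Site 4) : (siteMat W x).trace.im = 0 := by
  simp [siteMat, Matrix.trace_add, Matrix.trace_sum, Complex.add_im, Complex.im_sum, NarrowWell.trace_im_eq_zero]

/-- **H4b.0b**: an interior minimiser of the Landau functional is in lattice Landau gauge at every interior site. -/
theorem inLandauGauge_of_isMinOn (U : LGConfig 4 SU2) (g : Site 4 → SU2) (hg : IsInteriorGauge H g)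
    (hmin : ∀ g' : Site 4 → SU2, IsInteriorGauge H g' → landauFunctional H U g ≤ landauFunctional H U g') :
    InLandauGauge H (gaugeTransformZd g U) := by
  intro x hx
  set W := gaugeTransformZd g U with hW
  -- the variational inequality `Re tr (q N) ≤ Re tr N`
  have hvar : ∀ q : SU2, ((q : Matrix (Fin 2) (Fin 2) ℂ) * siteMat W x).trace.re ≤ (siteMat W x).trace.re := by
    intro q
    have h := hmin _ (update_isInteriorGauge hg hx q)
    rw [landauFunctional_update U g hx q, ← hW, Matrix.sub_mul, Matrix.one_mul, Matrix.trace_sub, Complex.sub_re] at h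
    linarith
  have hN := SU2Key.conjTranspose_eq_of_forall_re_trace_le (siteMat W x) (siteMat_trace_im W x) hvar
  simp only [siteMat, Matrix.conjTranspose_add, Matrix.conjTranspose_sum, Matrix.conjTranspose_conjTranspose] at hN
  rw [Finset.sum_sub_distrib, Finset.sum_sub_distrib, sub_eq_sub_iff_add_eq_add]
  exact hN.symm.trans (add_comm _ _)

/-- **H4b.0a + H4b.0b**: every configuration admits an interior gauge transform which MINIMISES the Landau functional over
interior gauges and (hence) puts it in lattice Landau gauge at all interior sites of the cold box (crude representative:
existence + Landau condition; the size bound is H4b.0c, by comparison with the temporal-forest representative). -/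
theorem exists_interior_landauGauge_min (H : ℕ) (U : LGConfig 4 SU2) :
    ∃ g : Site 4 → SU2, IsInteriorGauge H g ∧ InLandauGauge H (gaugeTransformZd g U) ∧
      ∀ g' : Site 4 → SU2, IsInteriorGauge H g' → landauFunctional H U g ≤ landauFunctional H U g' := by
  obtain ⟨g, hg, hmin⟩ := exists_isMinOn_landauFunctional H U
  exact ⟨g, hg, inLandauGauge_of_isMinOn U g hg hmin, hmin⟩

end Summit.QuantumFields.YangMills.Theorems.AllWindowsColdBoxBoxHighLine

/-! ## H4b.0c — the CRUDE size bound: compare the minimiser with the temporal-forest representative `forestFix H U`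
(`WeakCouplingRatesColdBoxForestGauge`), whose links cost `≤ ((12H²+2H+1)·s)²` on `ColdWall ∧ SmallPlaquettes s`
(`WeakCouplingRates.linkCost_le_of_plaqCost_le`, the forest Poincaré ladder), summed over `#boxEdges ≤ 4(2H+1)⁴` links. -/
section H4b0c

namespace Summit.QuantumFields.YangMills.Theorems.AllWindowsColdBoxBoxHighLine

open Literature.Probability.LatticeModels (Site)
open Literature.MathematicalPhysics.QuantumLattice
open Finset

/-- The temporal-forest gauge transform is an interior gauge transform. -/
theorem forestGauge_isInteriorGauge (H : ℕ) (U : LGConfig 4 SU2) : IsInteriorGauge H (forestGauge H U) := by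
  intro x hx
  rw [interiorSites_iff] at hx
  exact forestGauge_of_not_interior U hx

/-- Base points of plaquettes touching the cold box lie in `[−1, 2H]⁴` (the range of `SmallPlaquettes`). -/
theorem base_bounds_of_mem_plaquettesTouching {H : ℕ} {p : ZdPlaquette 4}
    (hp : p ∈ plaquettesTouching (boxEdges 4 (2 * H + 1))) (k : Fin 4) :
    -1 ≤ p.1 k ∧ p.1 k ≤ 2 * (H : ℤ) := by
  rw [mem_plaquettesTouching_iff] at hp
  obtain ⟨e, he⟩ := hp
  rw [Finset.mem_inter] at he
  obtain ⟨he1, he2⟩ := he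
  obtain ⟨y, i⟩ := e
  rw [mem_boxEdges_iff] at he2
  have hy := he2.1 k
  push_cast at hy
  simp only [plaquetteEdges, Finset.mem_insert, Finset.mem_singleton, Prod.mk.injEq] at he1
  rcases he1 with ⟨rfl, -⟩ | ⟨rfl, -⟩ | ⟨rfl, -⟩ | ⟨rfl, -⟩
  · constructor <;> omega
  · simp only [Pi.add_apply, Pi.single_apply] at hy
    split_ifs at hy <;> constructor <;> omega
  · simp only [Pi.add_apply, Pi.single_apply] at hy
    split_ifs at hy <;> constructor <;> omega
  · constructor <;> omega

/-- Every link of the forest representative of a cold-wall small-field configuration costs `≤ ((12H²+2H+1)·s)²`. -/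
theorem linkDefect_forestFix_le {H : ℕ} (hH : 1 ≤ H) {s : ℝ} (hs : 0 ≤ s) {U : LGConfig 4 SU2}
    (hW : ColdWall H U) (hS : SmallPlaquettes H s U) (e : Literature.MathematicalPhysics.QuantumLattice.ZdEdge 4) :
    linkDefect (forestFix H U) e ≤ ((12 * (H : ℝ) ^ 2 + 2 * H + 1) * s) ^ 2 := by
  unfold linkDefect
  exact linkCost_le_of_plaqCost_le hH (forestFix H U)
    (fun e he => by rw [forestFix_apply_of_not_mem_boxEdges U he]; exact hW e he)
    (fun x hx => forestFix_forest U hx) hs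
    (fun p hp => by
      rw [plaqCostAt_forestFix]
      exact hS p.1 (base_bounds_of_mem_plaquettesTouching hp) p.2.1.1 p.2.1.2 (ne_of_lt p.2.2)) e

/-- The Landau functional of the forest gauge is `≤ 72900·H⁸·s²` on `ColdWall ∧ SmallPlaquettes s` (`H ≥ 1`, `s ≥ 0`). -/
theorem landauFunctional_forestGauge_le {H : ℕ} (hH : 1 ≤ H) {s : ℝ} (hs : 0 ≤ s) {U : LGConfig 4 SU2}
    (hW : ColdWall H U) (hS : SmallPlaquettes H s U) :
    landauFunctional H U (forestGauge H U) ≤ 72900 * (H : ℝ) ^ 8 * s ^ 2 := by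
  have h1 : landauFunctional H U (forestGauge H U) ≤
      ∑ e ∈ boxEdges 4 (2 * H + 1), ((12 * (H : ℝ) ^ 2 + 2 * H + 1) * s) ^ 2 :=
    Finset.sum_le_sum fun e _ => linkDefect_forestFix_le hH hs hW hS e
  rw [Finset.sum_const, nsmul_eq_mul] at h1
  have hH' : (1 : ℝ) ≤ H := by exact_mod_cast hH
  have hcard : (#(boxEdges 4 (2 * H + 1)) : ℝ) ≤ 4 * (2 * (H : ℝ) + 1) ^ 4 := by
    exact_mod_cast card_boxEdges_four_le (2 * H + 1)
  have h2 : (2 * (H : ℝ) + 1) ^ 4 ≤ (3 * (H : ℝ)) ^ 4 := pow_le_pow_left₀ (by positivity) (by linarith) 4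
  have h3 : ((12 * (H : ℝ) ^ 2 + 2 * H + 1) * s) ^ 2 ≤ (15 * (H : ℝ) ^ 2 * s) ^ 2 := by
    refine pow_le_pow_left₀ (by positivity) ?_ 2
    have h : 12 * (H : ℝ) ^ 2 + 2 * H + 1 ≤ 15 * (H : ℝ) ^ 2 := by nlinarith
    calc (12 * (H : ℝ) ^ 2 + 2 * H + 1) * s ≤ 15 * (H : ℝ) ^ 2 * s := mul_le_mul_of_nonneg_right h hs
      _ = 15 * (H : ℝ) ^ 2 * s := rfl
  calc landauFunctional H U (forestGauge H U)
      ≤ (#(boxEdges 4 (2 * H + 1)) : ℝ) * ((12 * (H : ℝ) ^ 2 + 2 * H + 1) * s) ^ 2 := h1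
    _ ≤ (4 * (3 * (H : ℝ)) ^ 4) * (15 * (H : ℝ) ^ 2 * s) ^ 2 :=
        mul_le_mul (hcard.trans (by linarith)) h3 (by positivity) (by positivity)
    _ = 72900 * (H : ℝ) ^ 8 * s ^ 2 := by ring

/-- **H4b.0c (crude Landau representative)**: on `ColdWall ∧ SmallPlaquettes s` some interior gauge transform puts `U` in lattice
Landau gauge with TOTAL link defect `≤ 72900·H⁸·s²` (existence + Landau condition + crude size; the sharp per-link bound is S4b proper). -/
theorem landauMin_le_forest : ∃ C : ℝ, 0 < C ∧ ∀ H : ℕ, 1 ≤ H → ∀ s : ℝ, 0 ≤ s → ∀ U : LGConfig 4 SU2,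
    ColdWall H U → SmallPlaquettes H s U →
      ∃ g : Site 4 → SU2, IsInteriorGauge H g ∧ InLandauGauge H (gaugeTransformZd g U) ∧
        landauFunctional H U g ≤ C * (H : ℝ) ^ 8 * s ^ 2 :=
  ⟨72900, by norm_num, fun H hH s hs U hW hS => by
    obtain ⟨g, hg, hL, hmin⟩ := exists_interior_landauGauge_min H U
    exact ⟨g, hg, hL, (hmin _ (forestGauge_isInteriorGauge H U)).trans (landauFunctional_forestGauge_le hH hs hW hS)⟩⟩

/-- Link defects of `SU(2)` configurations are nonnegative (`Re tr W ≤ 2`). -/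
theorem linkDefect_nonneg (V : LGConfig 4 SU2) (e : Literature.MathematicalPhysics.QuantumLattice.ZdEdge 4) : 0 ≤ linkDefect V e := by
  unfold linkDefect
  have h := trace_re_le_two (V e)
  rw [fundamentalRep_apply] at h
  push_cast at h
  linarith

/-- Corollary in `InGaugeBall` form: a Landau-gauge representative with every box link within defect-radius `√(72900·H⁸)·s`
(each term of the nonnegative sum is bounded by the sum). -/
theorem exists_landau_inGaugeBall {H : ℕ} (hH : 1 ≤ H) {s : ℝ} (hs : 0 ≤ s) {U : LGConfig 4 SU2}
    (hW : ColdWall H U) (hS : SmallPlaquettes H s U) :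
    ∃ g : Site 4 → SU2, IsInteriorGauge H g ∧ InLandauGauge H (gaugeTransformZd g U) ∧
      ∀ e ∈ boxEdges 4 (2 * H + 1), linkDefect (gaugeTransformZd g U) e ≤ 72900 * (H : ℝ) ^ 8 * s ^ 2 := by
  obtain ⟨g, hg, hL, hmin⟩ := exists_interior_landauGauge_min H U
  refine ⟨g, hg, hL, fun e he => ?_⟩
  have hle := (hmin _ (forestGauge_isInteriorGauge H U)).trans (landauFunctional_forestGauge_le hH hs hW hS)
  refine le_trans ?_ hle
  unfold landauFunctional
  exact Finset.single_le_sum (f := fun e => linkDefect (gaugeTransformZd g U) e)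
    (fun e' _ => linkDefect_nonneg (gaugeTransformZd g U) e') he

end Summit.QuantumFields.YangMills.Theorems.AllWindowsColdBoxBoxHighLine

end H4b0c

end
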